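import Summits.Ventures.HodgeRepro2.T5InertGlobalToLocal

/-!
# T5LocalDegreeBounds — consequences of the local degree formula: `[L_w : K_v] ≤ [L : K]`,
the split places (`K_v = L_w`), and the two local degrees of a quadratic extension

Tier-5 kernel support (N3) — p8, gen 15.  §8(d): uses an L-value-free non-vanishing device: NO.

From `T5InertGlobalToLocal.finrank_adicCompletion_eq_mul` (`[L_w : K_v] = e(w/v) · f(w/v)`) and
Mathlib's `Ideal.sum_ramification_inertia`:
* `finrank_adicCompletion_le_finrank` — `[L_w : K_v] ≤ [L : K]`;
* `finrank_adicCompletion_eq_one_iff` — `[L_w : K_v] = 1 ↔ e(w/v) = 1 ∧ f(w/v) = 1`;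
* `bijective_algebraMap_adicCompletion_of_split` — at a place with `e = f = 1` («`v` splits at
  `w`») the completion does not grow: `K_v → L_w` is bijective (the record's «`E_v = F_v × F_v`»
  at a split place, one factor);
* `finrank_adicCompletion_eq_one_or_two` — for a quadratic `L / K` the local degree is `1` or `2`,
  and `= 2` exactly when `(e, f) = (1, 2)` (inert) or `(2, 1)` (ramified):
  `ramificationIdx'_inertiaDeg'_of_quadratic`.

Nothing here identifies which places of the datum are split, inert or ramified.
-/

namespace Summit.Ventures.HodgeRepro2.T5LocalDegreeBounds

open IsDedekindDomain HeightOneSpectrum NumberField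

variable {K : Type*} [Field K] [NumberField K] (v : HeightOneSpectrum (RingOfIntegers K))
variable {L : Type*} [Field L] [NumberField L] [Algebra K L]
  (w : HeightOneSpectrum (RingOfIntegers L)) [w.asIdeal.LiesOver v.asIdeal]

/-- `e(w/v) · f(w/v) ≤ [L : K]`: one term of Mathlib's `Σ_{P ∣ v} e f = [L : K]`. -/
theorem ramificationIdx'_mul_inertiaDeg'_le_finrank :
    v.asIdeal.ramificationIdx' w.asIdeal * v.asIdeal.inertiaDeg' w.asIdeal ≤
      Module.finrank K L := by
  classical
  haveI : v.asIdeal.IsMaximal := v.isMaximal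
  rw [← Ideal.sum_ramification_inertia (𝓞 L) K L (p := v.asIdeal) v.ne_bot]
  refine Finset.single_le_sum (f := fun P => v.asIdeal.ramificationIdx' P * v.asIdeal.inertiaDeg' P)
    (fun _ _ => Nat.zero_le _) ?_
  exact (IsDedekindDomain.mem_primesOverFinset_iff v.ne_bot _).2 ⟨w.isPrime, inferInstance⟩

/-- THE LOCAL DEGREE IS BOUNDED BY THE GLOBAL ONE: `[L_w : K_v] ≤ [L : K]`. -/
theorem finrank_adicCompletion_le_finrank :
    Module.finrank (v.adicCompletion K) (w.adicCompletion L) ≤ Module.finrank K L := by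
  rw [T5InertGlobalToLocal.finrank_adicCompletion_eq_mul v w]
  exact ramificationIdx'_mul_inertiaDeg'_le_finrank v w

/-- `[L_w : K_v] = 1` iff `e(w/v) = 1` and `f(w/v) = 1`. -/
theorem finrank_adicCompletion_eq_one_iff :
    Module.finrank (v.adicCompletion K) (w.adicCompletion L) = 1 ↔
      v.asIdeal.ramificationIdx' w.asIdeal = 1 ∧ v.asIdeal.inertiaDeg' w.asIdeal = 1 := by
  rw [T5InertGlobalToLocal.finrank_adicCompletion_eq_mul v w, mul_eq_one]

/-- At a split place (`e(w/v) = f(w/v) = 1`) the local degree is `1`. -/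
theorem finrank_adicCompletion_eq_one_of_split (he : v.asIdeal.ramificationIdx' w.asIdeal = 1)
    (hf : v.asIdeal.inertiaDeg' w.asIdeal = 1) :
    Module.finrank (v.adicCompletion K) (w.adicCompletion L) = 1 :=
  (finrank_adicCompletion_eq_one_iff v w).2 ⟨he, hf⟩

/-- At a split place the completion does not grow: `K_v → L_w` is bijective. -/
theorem bijective_algebraMap_adicCompletion_of_split
    (he : v.asIdeal.ramificationIdx' w.asIdeal = 1) (hf : v.asIdeal.inertiaDeg' w.asIdeal = 1) :
    Function.Bijective (algebraMap (v.adicCompletion K) (w.adicCompletion L)) :=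
  Algebra.finrank_eq_one_iff_bijective_algebraMap.1 (finrank_adicCompletion_eq_one_of_split v w he hf)

/-- For a quadratic `L / K` the local degree at any place is `1` or `2`. -/
theorem finrank_adicCompletion_eq_one_or_two (h2 : Module.finrank K L = 2) :
    Module.finrank (v.adicCompletion K) (w.adicCompletion L) = 1 ∨
      Module.finrank (v.adicCompletion K) (w.adicCompletion L) = 2 := by
  have hle := finrank_adicCompletion_le_finrank v w
  have hpos : 0 < Module.finrank (v.adicCompletion K) (w.adicCompletion L) :=
    Module.finrank_pos
  rw [h2] at hle
  omega

/-- For a quadratic `L / K`, a place of local degree `2` is either inert (`e = 1`, `f = 2`) or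
ramified (`e = 2`, `f = 1`). -/
theorem ramificationIdx'_inertiaDeg'_of_quadratic
    (h2 : Module.finrank (v.adicCompletion K) (w.adicCompletion L) = 2) :
    (v.asIdeal.ramificationIdx' w.asIdeal = 1 ∧ v.asIdeal.inertiaDeg' w.asIdeal = 2) ∨
      (v.asIdeal.ramificationIdx' w.asIdeal = 2 ∧ v.asIdeal.inertiaDeg' w.asIdeal = 1) := by
  rw [T5InertGlobalToLocal.finrank_adicCompletion_eq_mul v w] at h2
  rcases Nat.prime_two.eq_one_or_self_of_dvd _ (Dvd.intro _ h2) with he | he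
  · left
    refine ⟨he, ?_⟩
    rwa [he, one_mul] at h2
  · right
    refine ⟨he, ?_⟩
    rw [he] at h2
    omega

end Summit.Ventures.HodgeRepro2.T5LocalDegreeBounds
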